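import Summits.MatrixMultiplication.MatrixMultiplication.Theorems.OutsiderSandwichBorderTable
import HarnessLib

/-!
# The border table is THE currency of the leaf: `θ⋆ = inf_{N,m} log₂(a̲(N,m)/m)/N`

Route `OutsiderSandwich` (decomposition cell `decomp-mm`, lens 4 «minimal counterexample /
extremal reduction», gen 29), support for the aside leaf `BlockOneIsMM`
(stmt-MatrixMultiplication-27147).

The exchange exponent of the route is DEFINED from restriction certificates with `m = 1`
(`exchangeExponent = sInf {θ | ExponentAchieved θ}`, `ExponentAchieved θ` = cofinally in `N` some
`B ≤ 2^{θN}` copies of `C₁^{⊠N}` RESTRICT to `⟨2,2,2⟩^{⊠N}`).  The amortised border table of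
`OutsiderSandwichBorderTable` prices the larger family of certificates
`⟨B⟩ ⊠ C₁^{⊠N} ⊵_deg ⟨m⟩ ⊠ ⟨2,2,2⟩^{⊠N}` (`AmortisedDeg N B m`, least `B` = `a̲(N,m)`), each giving
`θ⋆ ≤ log₂(B/m)/N` (`exchangeExponent_le_of_amortisedDeg`).  This file closes the loop: the larger
family has the SAME infimum, so the border table is an exact currency for the leaf, and every rate
above `θ⋆` is witnessed by a table entry.

* `exchangeExponent_eq_sInf_amortisedDeg` — `θ⋆ = inf { log₂(B/m)/N : N, m ≥ 1, AmortisedDeg N B m }`;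
* `exchangeExponent_eq_sInf_borderAmortisedNumber` — `θ⋆ = inf_{N, m ≥ 1} log₂(a̲(N,m)/m)/N`;
* `exists_amortisedDeg_rate_lt` — every `θ > θ⋆` is beaten by some table entry
  (`log₂(a̲(N,m)/m)/N < θ`), already with `m = 1`;
* `blockOneIsMM_iff_sInf_borderTable_eq_zero` — the leaf ⟺ the table infimum is `0`.

## References
* V. Strassen, *The asymptotic spectrum of tensors*, J. reine angew. Math. 384 (1988), Thm. 3.8.
  [Strassen1988]
* P. Bürgisser, M. Clausen, M. A. Shokrollahi, *Algebraic Complexity Theory* (1997), (15.19)–(15.26).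
  [BurgisserClausenShokrollahi1997]
-/

noncomputable section

set_option linter.dupNamespace false
set_option autoImplicit false

namespace Summit.MatrixMultiplication.MatrixMultiplication.Theorems.OutsiderSandwichBorderCurrency

open Summit.MatrixMultiplication.MatrixMultiplication.Theorems.OutsiderSandwichExchangeRate
  (Helped two_le_of_helped)
open Summit.MatrixMultiplication.MatrixMultiplication.Theorems.OutsiderSandwichExchangeExponent
  (exchangeExponent exchangeExponent_nonneg eventually_helped_of_exchangeExponent_lt
    blockOneIsMM_iff_exchangeExponent_eq_zero)
open Summit.MatrixMultiplication.MatrixMultiplication.Theorems.OutsiderSandwichBorderExchange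
  (helpedDeg_of_helped)
open Summit.MatrixMultiplication.MatrixMultiplication.Theorems.OutsiderSandwichBorderTable
  (AmortisedDeg amortisedDeg_one_iff amortisedDeg_mul_two_pow borderAmortisedNumber
    amortisedDeg_borderAmortisedNumber borderAmortisedNumber_le borderAmortisedNumber_floor
    exchangeExponent_le_of_amortisedDeg)

/-! ## 1. The two rate sets -/

/-- The rates of all border certificates: `{ log₂(B/m)/N : N ≥ 1, m ≥ 1, ⟨B⟩⊠C₁^{⊠N} ⊵ ⟨m⟩⊠⟨2,2,2⟩^{⊠N} }`
(spelled out; no definition is introduced). [cite: Strassen1988, Thm. 3.8] -/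
theorem one_mem_rates :
    (1 : ℝ) ∈ {θ : ℝ | ∃ N B m : ℕ, 0 < N ∧ 0 < m ∧ AmortisedDeg N B m ∧
      θ = Real.logb 2 ((B : ℝ) / m) / N} := by
  refine ⟨1, 2, 1, Nat.one_pos, Nat.one_pos, ?_, ?_⟩
  · simpa using amortisedDeg_mul_two_pow 1 1
  · norm_num [Real.logb_self_eq_one]

/-- Every border-certificate rate bounds `θ⋆` from above. [cite: Strassen1988, Thm. 3.8] -/
theorem exchangeExponent_le_of_mem_rates {θ : ℝ}
    (hθ : θ ∈ {θ : ℝ | ∃ N B m : ℕ, 0 < N ∧ 0 < m ∧ AmortisedDeg N B m ∧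
      θ = Real.logb 2 ((B : ℝ) / m) / N}) : exchangeExponent ≤ θ := by
  obtain ⟨N, B, m, hN, hm, h, rfl⟩ := hθ
  exact exchangeExponent_le_of_amortisedDeg hN hm h

/-- The rate set is bounded below (by `θ⋆`). [folklore] -/
theorem rates_bddBelow :
    BddBelow {θ : ℝ | ∃ N B m : ℕ, 0 < N ∧ 0 < m ∧ AmortisedDeg N B m ∧
      θ = Real.logb 2 ((B : ℝ) / m) / N} :=
  ⟨exchangeExponent, fun _ hθ => exchangeExponent_le_of_mem_rates hθ⟩

/-- **Every rate above `θ⋆` is beaten by a certificate with `m = 1`** (padding,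
`eventually_helped_of_exchangeExponent_lt`). [folklore] -/
theorem exists_helped_rate_le {θ : ℝ} (h : exchangeExponent < θ) :
    ∃ N B : ℕ, 0 < N ∧ 0 < B ∧ Helped N B ∧ Real.logb 2 (B : ℝ) / N ≤ θ := by
  obtain ⟨N₀, hN₀⟩ := eventually_helped_of_exchangeExponent_lt h
  obtain ⟨B, hB, hBle⟩ := hN₀ (max N₀ 1) (le_max_left _ _)
  have hN : 0 < max N₀ 1 := lt_of_lt_of_le Nat.one_pos (le_max_right _ _)
  have hB2 : 2 ≤ B := two_le_of_helped hN hB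
  have hBpos : (0 : ℝ) < B := by exact_mod_cast (lt_of_lt_of_le (by norm_num) hB2 : 0 < B)
  refine ⟨max N₀ 1, B, hN, by omega, hB, ?_⟩
  rw [div_le_iff₀ (by exact_mod_cast hN)]
  exact (Real.logb_le_iff_le_rpow one_lt_two hBpos).2 hBle

/-- The same, as a member of the border rate set strictly below any `θ > θ⋆`. [folklore] -/
theorem exists_mem_rates_lt {θ : ℝ} (h : exchangeExponent < θ) :
    ∃ θ' ∈ {θ : ℝ | ∃ N B m : ℕ, 0 < N ∧ 0 < m ∧ AmortisedDeg N B m ∧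
      θ = Real.logb 2 ((B : ℝ) / m) / N}, θ' < θ := by
  have h1 : exchangeExponent < (exchangeExponent + θ) / 2 := by linarith
  obtain ⟨N, B, hN, hB, hH, hle⟩ := exists_helped_rate_le h1
  refine ⟨Real.logb 2 ((B : ℝ) / (1 : ℕ)) / N, ⟨N, B, 1, hN, Nat.one_pos,
    (amortisedDeg_one_iff N B).2 (helpedDeg_of_helped hH), rfl⟩, ?_⟩
  have : Real.logb 2 ((B : ℝ) / (1 : ℕ)) / N = Real.logb 2 (B : ℝ) / N := by simp
  rw [this]
  linarith

/-! ## 2. `θ⋆` is the infimum of the border rates -/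

/-- **`θ⋆ = inf { log₂(B/m)/N : N ≥ 1, m ≥ 1, AmortisedDeg N B m }`** — the amortised border
certificates have the same infimum as the defining restriction certificates.
[cite: Strassen1988, Thm. 3.8] -/
theorem exchangeExponent_eq_sInf_amortisedDeg :
    exchangeExponent = sInf {θ : ℝ | ∃ N B m : ℕ, 0 < N ∧ 0 < m ∧ AmortisedDeg N B m ∧
      θ = Real.logb 2 ((B : ℝ) / m) / N} := by
  refine le_antisymm (le_csInf ⟨1, one_mem_rates⟩ fun _ hθ => exchangeExponent_le_of_mem_rates hθ) ?_
  refine le_of_forall_gt_imp_ge_of_dense fun θ hθ => ?_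
  obtain ⟨θ', hmem, hlt⟩ := exists_mem_rates_lt hθ
  exact (csInf_le rates_bddBelow hmem).trans hlt.le

/-- **Every `θ > θ⋆` is beaten by a border-table entry**: `∃ N B m, AmortisedDeg N B m ∧ log₂(B/m)/N < θ`.
[folklore] -/
theorem exists_amortisedDeg_rate_lt {θ : ℝ} (h : exchangeExponent < θ) :
    ∃ N B m : ℕ, 0 < N ∧ 0 < m ∧ AmortisedDeg N B m ∧ Real.logb 2 ((B : ℝ) / m) / N < θ := by
  obtain ⟨θ', ⟨N, B, m, hN, hm, hd, rfl⟩, hlt⟩ := exists_mem_rates_lt h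
  exact ⟨N, B, m, hN, hm, hd, hlt⟩

/-! ## 3. In terms of the table `a̲(N, m)` -/

/-- `a̲(N, m) ≥ 1` for `N, m ≥ 1` (the floor). [new] -/
theorem borderAmortisedNumber_pos {N m : ℕ} (hN : 0 < N) (hm : 0 < m) :
    0 < borderAmortisedNumber N m := by
  obtain ⟨n, rfl⟩ : ∃ n, N = n + 1 := ⟨N - 1, by omega⟩
  have hf := borderAmortisedNumber_floor n m
  by_contra h0
  have h0' : borderAmortisedNumber (n + 1) m = 0 := by omega
  rw [h0'] at hf
  have : 0 < m * 4 ^ (n + 1) := by positivity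
  omega

/-- The table rate `log₂(a̲(N,m)/m)/N` is the least rate among certificates with the same `(N, m)`.
[new] -/
theorem table_rate_le {N B m : ℕ} (hN : 0 < N) (hm : 0 < m) (h : AmortisedDeg N B m) :
    Real.logb 2 ((borderAmortisedNumber N m : ℝ) / m) / N ≤ Real.logb 2 ((B : ℝ) / m) / N := by
  have hmpos : (0 : ℝ) < m := by exact_mod_cast hm
  have hapos : (0 : ℝ) < borderAmortisedNumber N m := by
    exact_mod_cast borderAmortisedNumber_pos hN hm
  have hle : (borderAmortisedNumber N m : ℝ) ≤ B := by exact_mod_cast borderAmortisedNumber_le h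
  exact div_le_div_of_nonneg_right
    (Real.logb_le_logb_of_le one_lt_two (div_pos hapos hmpos)
      (div_le_div_of_nonneg_right hle hmpos.le)) (by positivity)

/-- The table rates. [new] -/
theorem table_rate_mem_rates {N m : ℕ} (hN : 0 < N) (hm : 0 < m) :
    Real.logb 2 ((borderAmortisedNumber N m : ℝ) / m) / N ∈
      {θ : ℝ | ∃ N B m : ℕ, 0 < N ∧ 0 < m ∧ AmortisedDeg N B m ∧
        θ = Real.logb 2 ((B : ℝ) / m) / N} :=
  ⟨N, borderAmortisedNumber N m, m, hN, hm, amortisedDeg_borderAmortisedNumber N m, rfl⟩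

/-- **`θ⋆ = inf_{N, m ≥ 1} log₂(a̲(N,m)/m)/N`** — the amortised border table is an exact currency
for the exchange exponent. [cite: Strassen1988, Thm. 3.8] -/
theorem exchangeExponent_eq_sInf_borderAmortisedNumber :
    exchangeExponent = sInf {θ : ℝ | ∃ N m : ℕ, 0 < N ∧ 0 < m ∧
      θ = Real.logb 2 ((borderAmortisedNumber N m : ℝ) / m) / N} := by
  have hsub : ∀ θ ∈ {θ : ℝ | ∃ N m : ℕ, 0 < N ∧ 0 < m ∧
      θ = Real.logb 2 ((borderAmortisedNumber N m : ℝ) / m) / N},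
      θ ∈ {θ : ℝ | ∃ N B m : ℕ, 0 < N ∧ 0 < m ∧ AmortisedDeg N B m ∧
        θ = Real.logb 2 ((B : ℝ) / m) / N} := by
    rintro θ ⟨N, m, hN, hm, rfl⟩
    exact table_rate_mem_rates hN hm
  have hne : ({θ : ℝ | ∃ N m : ℕ, 0 < N ∧ 0 < m ∧
      θ = Real.logb 2 ((borderAmortisedNumber N m : ℝ) / m) / N}).Nonempty :=
    ⟨_, 1, 1, Nat.one_pos, Nat.one_pos, rfl⟩
  have hbdd : BddBelow {θ : ℝ | ∃ N m : ℕ, 0 < N ∧ 0 < m ∧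
      θ = Real.logb 2 ((borderAmortisedNumber N m : ℝ) / m) / N} :=
    ⟨exchangeExponent, fun θ hθ => exchangeExponent_le_of_mem_rates (hsub θ hθ)⟩
  rw [exchangeExponent_eq_sInf_amortisedDeg]
  refine le_antisymm (le_csInf hne fun θ hθ => csInf_le rates_bddBelow (hsub θ hθ)) ?_
  refine le_csInf ⟨1, one_mem_rates⟩ ?_
  rintro θ ⟨N, B, m, hN, hm, h, rfl⟩
  exact (csInf_le hbdd ⟨N, m, hN, hm, rfl⟩).trans (table_rate_le hN hm h)

/-- **Every `θ > θ⋆` is beaten by a table entry**: `∃ N m ≥ 1, log₂(a̲(N,m)/m)/N < θ`. [new] -/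
theorem exists_table_rate_lt {θ : ℝ} (h : exchangeExponent < θ) :
    ∃ N m : ℕ, 0 < N ∧ 0 < m ∧
      Real.logb 2 ((borderAmortisedNumber N m : ℝ) / m) / N < θ := by
  obtain ⟨N, B, m, hN, hm, hd, hlt⟩ := exists_amortisedDeg_rate_lt h
  exact ⟨N, m, hN, hm, (table_rate_le hN hm hd).trans_lt hlt⟩

/-- Conversely every table entry bounds `θ⋆`: `θ⋆ ≤ log₂(a̲(N,m)/m)/N`. [cite: Strassen1988, Thm. 3.8] -/
theorem exchangeExponent_le_table_rate {N m : ℕ} (hN : 0 < N) (hm : 0 < m) :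
    exchangeExponent ≤ Real.logb 2 ((borderAmortisedNumber N m : ℝ) / m) / N :=
  exchangeExponent_le_of_amortisedDeg hN hm (amortisedDeg_borderAmortisedNumber N m)

/-! ## 4. The leaf in table currency -/

/-- **`BlockOneIsMM ⟺ inf_{N,m} log₂(a̲(N,m)/m)/N = 0`.** [cite: Strassen1988, Thm. 3.8] -/
theorem blockOneIsMM_iff_sInf_borderTable_eq_zero :
    Theses.OutsiderSandwich.BlockOneIsMM ↔
      sInf {θ : ℝ | ∃ N m : ℕ, 0 < N ∧ 0 < m ∧
        θ = Real.logb 2 ((borderAmortisedNumber N m : ℝ) / m) / N} = 0 := by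
  rw [blockOneIsMM_iff_exchangeExponent_eq_zero, exchangeExponent_eq_sInf_borderAmortisedNumber]

/-- **`BlockOneIsMM ⟺ ∀ θ > 0, ∃ N m ≥ 1, log₂(a̲(N,m)/m)/N < θ`** (table entries of arbitrarily small
rate). [cite: Strassen1988, Thm. 3.8] -/
theorem blockOneIsMM_iff_forall_exists_table_rate_lt :
    Theses.OutsiderSandwich.BlockOneIsMM ↔
      ∀ θ : ℝ, 0 < θ → ∃ N m : ℕ, 0 < N ∧ 0 < m ∧
        Real.logb 2 ((borderAmortisedNumber N m : ℝ) / m) / N < θ := by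
  rw [blockOneIsMM_iff_exchangeExponent_eq_zero]
  constructor
  · intro h0 θ hθ
    exact exists_table_rate_lt (by rw [h0]; exact hθ)
  · intro h
    refine le_antisymm ?_ exchangeExponent_nonneg
    refine le_of_forall_gt_imp_ge_of_dense fun θ hθ => ?_
    obtain ⟨N, m, hN, hm, hlt⟩ := h θ hθ
    exact (exchangeExponent_le_table_rate hN hm).trans hlt.le

end Summit.MatrixMultiplication.MatrixMultiplication.Theorems.OutsiderSandwichBorderCurrency

end
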